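import Summits.SmoothPoincare4.SmoothPoincare4.Theorems.SymplecticOrigamiGromovRecognitionRelEndStubCapModelX1

/-!
# Wedge cap for `GromovRecognitionRelEnd` — gluing the manifold to the cap: `X = M ∪ Cap`
(stub `stub_capModel` of line `cross-cap-laurent`, crux `SymplecticOrigami.GromovRecognitionRelEnd`,
item stmt-SmoothPoincare4-11009)

The closed model `X` is the open gluing of `M` and the cap along
`gX : {x ∈ Kᶜ | |ψ₁ x| > R₁ ∨ |ψ₂ x| > R₁} ≅ (finite part of the cap)`, `x ↦ ofCoord (ψ x)`, inverse
`y ↦ χ (coord y)`. This file builds `gX`, the gluing datum `dX`, and proves that `X` is HAUSDORFF: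
the graph of `gX` is closed because (i) by Stub 1 every point of `M` has a neighbourhood on which
`‖ψ‖` is bounded (`EndHyp.exists_nhds_norm_ψ_lt`), while (ii) near a point of the wedge
`{z₁ = ∞} ∪ {z₂ = ∞}` of the cap the affine coordinates of finite points are unbounded
(`exists_nhds_lt_norm_coord`) — so closure points of the graph stay in the finite part, where the
inverse is continuous (`isClosed_graph_of_closure_subset_target`).
-/

noncomputable section

-- the registered namespace `Summit.SmoothPoincare4.SmoothPoincare4.Theorems…` repeats a component
set_option linter.dupNamespace false

open scoped Manifold ContDiff Topology
open Set Function Filter TopologicalSpace Literature.Geometry.Kaehler Literature.Geometry.Symplectic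
  Literature.Topology.FourManifolds

namespace Summit.SmoothPoincare4.SmoothPoincare4.Theorems.GromovRecognitionRelEnd.CrossCapLaurent

namespace CapModel

/-- Model space `ℝ⁴ = ℂ²` (coordinates `0,1` = `z₁`, `2,3` = `z₂`). -/
local notation "E4" => EuclideanSpace ℝ (Fin 4)

variable {R₁ : ℝ} [hR : Fact (0 < R₁)]

/-! ## The finite part of the cap -/

omit hR in
variable (R₁) in
/-- Admissible affine coordinates: `|z₁| > R₁` or `|z₂| > R₁`. [folklore] -/
def goodSet : Set E4 := {w | R₁ ^ 2 < r1 w ∨ R₁ ^ 2 < r2 w}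

omit hR in
/-- Membership in `goodSet`. [folklore] -/
theorem mem_goodSet {w : E4} : w ∈ goodSet R₁ ↔ R₁ ^ 2 < r1 w ∨ R₁ ^ 2 < r2 w := Iff.rfl

omit hR in
variable (R₁) in
/-- The admissible coordinates form an open set. [folklore] -/
theorem isOpen_good : IsOpen (goodSet R₁) :=
  (isOpen_lt continuous_const continuous_r1).union (isOpen_lt continuous_const continuous_r2)

variable (R₁) in
/-- **The finite part of the cap**: chart points off the axes. [folklore] -/
def capFin : Set (Cap R₁) := κV '' {b : OV R₁ | r1 b.1 ≠ 0} ∪ κH '' {b : OH R₁ | r2 b.1 ≠ 0}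

/-- The range of `κV` is open. [folklore] -/
theorem isOpen_range_κV : IsOpen (range (κV : OV R₁ → Cap R₁)) := by
  rw [range_comp]; exact (dC1 R₁).isOpenMap_inl _ (dVH R₁).isOpen_range_inl
/-- The range of `κH` is open. [folklore] -/
theorem isOpen_range_κH : IsOpen (range (κH : OH R₁ → Cap R₁)) := by
  rw [range_comp]; exact (dC1 R₁).isOpenMap_inl _ (dVH R₁).isOpen_range_inr
/-- `κV` is an open map. [folklore] -/
theorem isOpenMap_κV : IsOpenMap (κV : OV R₁ → Cap R₁) :=
  (dC1 R₁).isOpenMap_inl.comp (dVH R₁).isOpenMap_inl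
/-- `κH` is an open map. [folklore] -/
theorem isOpenMap_κH : IsOpenMap (κH : OH R₁ → Cap R₁) :=
  (dC1 R₁).isOpenMap_inl.comp (dVH R₁).isOpenMap_inr

/-- The finite part is open. [folklore] -/
theorem isOpen_capFin : IsOpen (capFin R₁) :=
  (isOpenMap_κV _ (isOpen_r1_ne.preimage continuous_subtype_val)).union
    (isOpenMap_κH _ (isOpen_r2_ne.preimage continuous_subtype_val))

/-- Admissible coordinates give finite points. [folklore] -/
theorem ofCoord_mem_capFin {w : E4} (hw : w ∈ goodSet R₁) : (ofCoord w : Cap R₁) ∈ capFin R₁ := by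
  rcases hw with h1 | h2
  · refine Or.inl ⟨mkV (inv1 w), ?_, (ofCoord_of_r1 h1).symm⟩
    show r1 (mkV (inv1 w)).1 ≠ 0
    rw [mkV, val_toOpens (r1_inv1_lt hR.out h1), r1_inv1]
    exact inv_ne_zero (r1_ne_zero_of_sq_lt h1)
  · refine Or.inr ⟨mkH (inv2 w), ?_, (ofCoord_of_r2 h2).symm⟩
    show r2 (mkH (inv2 w)).1 ≠ 0
    rw [mkH, val_toOpens (r2_inv2_lt hR.out h2), r2_inv2]
    exact inv_ne_zero (r2_ne_zero_of_sq_lt h2)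

/-- Finite points have admissible coordinates and are recovered from them. [folklore] -/
theorem good_coord {y : Cap R₁} (hy : y ∈ capFin R₁) : coord y ∈ goodSet R₁ ∧ ofCoord (coord y) = y := by
  rcases hy with ⟨b, hb, rfl⟩ | ⟨b, hb, rfl⟩
  · have hb' : r1 b.1 ≠ 0 := hb
    rw [coord_κV]
    exact ⟨Or.inl (sq_lt_r1_inv1 hb' b.2), (κV_eq_ofCoord hb').symm⟩
  · have hb' : r2 b.1 ≠ 0 := hb
    rw [coord_κH]
    exact ⟨Or.inr (sq_lt_r2_inv2 hb' b.2), (κH_eq_ofCoord hb').symm⟩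

/-- `coord` is `C^∞` at the finite points. [folklore] -/
theorem contMDiffAt_coord {y : Cap R₁} (hy : y ∈ capFin R₁) :
    ContMDiffAt 𝓘(ℝ, E4) 𝓘(ℝ, E4) ∞ (coord : Cap R₁ → E4) y := by
  rcases hy with ⟨b, hb, rfl⟩ | ⟨b, hb, rfl⟩
  · exact contMDiffAt_coord_κV hb
  · exact contMDiffAt_coord_κH hb

/-- `ofCoord` is `C^∞` at the admissible coordinates. [folklore] -/
theorem contMDiffAt_ofCoord {w : E4} (hw : w ∈ goodSet R₁) :
    ContMDiffAt 𝓘(ℝ, E4) 𝓘(ℝ, E4) ∞ (ofCoord : E4 → Cap R₁) w := by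
  rcases hw with h1 | h2
  · exact contMDiffAt_ofCoord_of_r1 h1
  · exact contMDiffAt_ofCoord_of_r2 h2

/-- `mkH` is injective on `OH`-valued arguments. [folklore] -/
theorem mkH_inj {x y : E4} (hx : x ∈ OH R₁) (hy : y ∈ OH R₁) (h : (mkH x : OH R₁) = mkH y) : x = y := by
  have := congrArg Subtype.val h
  rwa [mkH, val_toOpens hx, val_toOpens hy] at this

/-! ## Near the wedge, affine coordinates blow up -/

omit hR in
/-- From `(r)⁻¹ < (B²)⁻¹` to `B < ‖w‖`. [folklore] -/
theorem lt_norm_of_inv_lt {B s : ℝ} (hB : 0 < B) (hs : 0 < s) {w : E4} (hsw : s ≤ ‖w‖ ^ 2)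
    (h : s⁻¹ < (B ^ 2)⁻¹) : B < ‖w‖ := by
  have h1 : B ^ 2 < s := (inv_lt_inv₀ hs (by positivity)).1 h
  exact lt_of_pow_lt_pow_left₀ 2 (norm_nonneg w) (h1.trans_le hsw)

/-- **Near a wedge point the coordinates of finite points are large.** [folklore] -/
theorem exists_nhds_lt_norm_coord {y : Cap R₁} (hy : y ∉ capFin R₁) (B : ℝ) :
    ∃ U ∈ 𝓝 y, ∀ w : E4, w ∈ goodSet R₁ → (ofCoord w : Cap R₁) ∈ U → B < ‖w‖ := by
  -- reduce to a positive bound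
  set B' : ℝ := max B 1 with hB'
  have hB'pos : 0 < B' := lt_of_lt_of_le one_pos (le_max_right _ _)
  suffices h : ∃ U ∈ 𝓝 y, ∀ w : E4, w ∈ goodSet R₁ → (ofCoord w : Cap R₁) ∈ U → B' < ‖w‖ by
    obtain ⟨U, hU, h⟩ := h
    exact ⟨U, hU, fun w hw hU' => lt_of_le_of_lt (le_max_left _ _) (h w hw hU')⟩
  set ε : ℝ := (B' ^ 2)⁻¹ with hε
  have hεpos : 0 < ε := by positivity
  rcases (dC1 R₁).exists_inl_or_inr y with ⟨y₁, rfl⟩ | ⟨c₀, rfl⟩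
  · rcases (dVH R₁).exists_inl_or_inr y₁ with ⟨b₀, rfl⟩ | ⟨b₀, rfl⟩
    · -- a point `κV b₀` of the sphere `{z₁ = ∞}`: `r1 b₀ = 0`
      have hb₀ : r1 b₀.1 = 0 := by
        by_contra h; exact hy (Or.inl ⟨b₀, h, rfl⟩)
      refine ⟨κV '' {b : OV R₁ | r1 b.1 < ε}, (isOpenMap_κV _ ((isOpen_lt continuous_r1
        continuous_const).preimage continuous_subtype_val)).mem_nhds ⟨b₀, by
          show r1 b₀.1 < ε; rw [hb₀]; exact hεpos, rfl⟩, ?_⟩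
      rintro w hw ⟨b, hb, hbw⟩
      have hb' : r1 b.1 < ε := hb
      by_cases h1 : R₁ ^ 2 < r1 w
      · rw [ofCoord_of_r1 h1] at hbw
        have hbv : b = mkV (inv1 w) := κV_injective hbw
        rw [hbv, mkV, val_toOpens (r1_inv1_lt hR.out h1), r1_inv1] at hb'
        exact lt_norm_of_inv_lt hB'pos (lt_of_le_of_lt (sq_nonneg _) h1) (r1_le_norm_sq w) hb'
      · have h2 : R₁ ^ 2 < r2 w := Or.resolve_left hw h1
        rw [ofCoord_of_r2 h2, eq_comm, κH_eq_κV_iff] at hbw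
        obtain ⟨⟨hr1, hr2⟩, hmk⟩ := hbw
        have heq : inv12 b.1 = inv2 w :=
          mkH_inj (inv12_mapsV b.2 hr1 hr2).1 (r2_inv2_lt hR.out h2) hmk
        have hr : r1 w = (r1 b.1)⁻¹ := by rw [← r1_inv2 w, ← heq, r1_inv12]
        have hpos : 0 < r1 b.1 := lt_of_le_of_ne (r1_nonneg _) (Ne.symm hr1)
        refine lt_norm_of_inv_lt hB'pos (by rw [hr]; positivity) (r1_le_norm_sq w) ?_
        rwa [hr, inv_inv]
    · -- a point `κH b₀` of the sphere `{z₂ = ∞}`: `r2 b₀ = 0`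
      have hb₀ : r2 b₀.1 = 0 := by
        by_contra h; exact hy (Or.inr ⟨b₀, h, rfl⟩)
      refine ⟨κH '' {b : OH R₁ | r2 b.1 < ε}, (isOpenMap_κH _ ((isOpen_lt continuous_r2
        continuous_const).preimage continuous_subtype_val)).mem_nhds ⟨b₀, by
          show r2 b₀.1 < ε; rw [hb₀]; exact hεpos, rfl⟩, ?_⟩
      rintro w hw ⟨b, hb, hbw⟩
      have hb' : r2 b.1 < ε := hb
      by_cases h2 : R₁ ^ 2 < r2 w
      · rw [ofCoord_of_r2 h2] at hbw
        have hbv : b = mkH (inv2 w) := κH_injective hbw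
        rw [hbv, mkH, val_toOpens (r2_inv2_lt hR.out h2), r2_inv2] at hb'
        exact lt_norm_of_inv_lt hB'pos (lt_of_le_of_lt (sq_nonneg _) h2) (r2_le_norm_sq w) hb'
      · have h1 : R₁ ^ 2 < r1 w := Or.resolve_right hw h2
        rw [ofCoord_of_r1 h1, κH_eq_κV_iff] at hbw
        obtain ⟨⟨-, hr2⟩, -⟩ := hbw
        rw [mkV, val_toOpens (r1_inv1_lt hR.out h1), r2_inv1] at hr2
        exact absurd hr2 h2
  · -- a corner-chart point `κC c₀` with `u = 0` or `t = 0`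
    have hc₀ : r1 c₀.1 = 0 ∨ r2 c₀.1 = 0 := by
      by_contra h
      simp only [not_or] at h
      apply hy
      have heq : κC c₀ = (κV (mkV (inv2 c₀.1)) : Cap R₁) := by
        rw [κC_eq_κV_iff, mkV, val_toOpens (inv2_mapsC c₀.2 h.2).1]
        exact ⟨(inv2_mapsC c₀.2 h.2).2, by
          apply Subtype.ext; rw [mkC, val_toOpens (by rw [inv2_inv2 h.2]; exact c₀.2), inv2_inv2 h.2]⟩
      show κC c₀ ∈ capFin R₁
      rw [heq]
      refine Or.inl ⟨_, ?_, rfl⟩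
      show r1 (mkV (inv2 c₀.1)).1 ≠ 0
      rw [mkV, val_toOpens (inv2_mapsC c₀.2 h.2).1, r1_inv2]; exact h.1
    -- in both cases, finite points `κC c` near `κC c₀` come from `w` with both coordinates large
    have key : ∀ (w : E4) (c : OC R₁), w ∈ goodSet R₁ → (ofCoord w : Cap R₁) = κC c →
        R₁ ^ 2 < r1 w ∧ R₁ ^ 2 < r2 w ∧ c.1 = inv12 w := by
      intro w c hw hwc
      by_cases h1 : R₁ ^ 2 < r1 w
      · rw [ofCoord_of_r1 h1, eq_comm, κC_eq_κV_iff, mkV, val_toOpens (r1_inv1_lt hR.out h1),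
          r2_inv1] at hwc
        obtain ⟨h2, hc⟩ := hwc
        refine ⟨h1, h2, ?_⟩
        rw [← hc, mkC, val_toOpens (inv2_mapsV (r1_inv1_lt hR.out h1) (by rwa [r2_inv1])).1, inv12]
      · have h2 : R₁ ^ 2 < r2 w := Or.resolve_left hw h1
        rw [ofCoord_of_r2 h2, eq_comm, κC_eq_κH_iff, mkH, val_toOpens (r2_inv2_lt hR.out h2),
          r1_inv2] at hwc
        exact absurd hwc.1 h1
    rcases hc₀ with hc₀ | hc₀
    · refine ⟨κC '' {c : OC R₁ | r1 c.1 < ε}, ((dC1 R₁).isOpenMap_inr _ ((isOpen_lt continuous_r1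
        continuous_const).preimage continuous_subtype_val)).mem_nhds ⟨c₀, by
          show r1 c₀.1 < ε; rw [hc₀]; exact hεpos, rfl⟩, ?_⟩
      rintro w hw ⟨c, hc, hcw⟩
      obtain ⟨h1, -, hval⟩ := key w c hw hcw.symm
      have hc' : r1 c.1 < ε := hc
      rw [hval, r1_inv12] at hc'
      exact lt_norm_of_inv_lt hB'pos (lt_of_le_of_lt (sq_nonneg _) h1) (r1_le_norm_sq w) hc'
    · refine ⟨κC '' {c : OC R₁ | r2 c.1 < ε}, ((dC1 R₁).isOpenMap_inr _ ((isOpen_lt continuous_r2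
        continuous_const).preimage continuous_subtype_val)).mem_nhds ⟨c₀, by
          show r2 c₀.1 < ε; rw [hc₀]; exact hεpos, rfl⟩, ?_⟩
      rintro w hw ⟨c, hc, hcw⟩
      obtain ⟨-, h2, hval⟩ := key w c hw hcw.symm
      have hc' : r2 c.1 < ε := hc
      rw [hval, r2_inv12] at hc'
      exact lt_norm_of_inv_lt hB'pos (lt_of_le_of_lt (sq_nonneg _) h2) (r2_le_norm_sq w) hc'

/-! ## The gluing map `M ⇀ Cap` and the glued space `X` -/

variable {M : Type} [TopologicalSpace M] [T2Space M] [ChartedSpace E4 M] [IsManifold (𝓡 4) ∞ M]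
  {sf : MForm (𝓡 4) M ℝ 2} {K : Set M} {R : ℝ} {ψ : M → E4} {χ : E4 → M}
  {J : AlmostComplexStructure (𝓡 4) ∞ M}

omit hR [T2Space M] in
/-- Admissible coordinates are beyond `R₁` and `R`. [folklore] -/
theorem EndHyp.lt_norm_of_good (H : EndHyp sf K R ψ χ R₁ J) {w : E4} (hw : w ∈ goodSet R₁) :
    R₁ < ‖w‖ ∧ R < ‖w‖ := by
  rcases hw with h | h
  · exact H.lt_norm_of_r1 h
  · exact H.lt_norm_of_r2 h

/-- **The gluing partial homeomorphism `M ⇀ Cap`**: `x ↦ ofCoord (ψ x)` on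
`{x ∈ Kᶜ | |ψ₁ x| > R₁ ∨ |ψ₂ x| > R₁}`, inverse `y ↦ χ (coord y)` on the finite part. [folklore] -/
def gX (H : EndHyp sf K R ψ χ R₁ J) : OpenPartialHomeomorph M (Cap R₁) where
  toFun x := ofCoord (ψ x)
  invFun y := χ (coord y)
  source := {x | x ∈ Kᶜ ∧ ψ x ∈ goodSet R₁}
  target := capFin R₁
  map_source' _ hx := ofCoord_mem_capFin hx.2
  map_target' y hy := by
    obtain ⟨hg, -⟩ := good_coord hy
    obtain ⟨hK, hψ⟩ := H.χ_spec (H.lt_norm_of_good hg).2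
    exact ⟨hK, by rw [hψ]; exact hg⟩
  left_inv' x hx := by
    show χ (coord (ofCoord (ψ x))) = x
    rw [coord_ofCoord hx.2, H.left_inv x hx.1]
  right_inv' y hy := by
    obtain ⟨hg, he⟩ := good_coord hy
    show ofCoord (ψ (χ (coord y))) = y
    rw [(H.χ_spec (H.lt_norm_of_good hg).2).2, he]
  open_source := H.smooth_ψ.continuousOn.isOpen_inter_preimage H.isOpen_compl_K (isOpen_good R₁)
  open_target := isOpen_capFin
  continuousOn_toFun x hx := ((contMDiffAt_ofCoord hx.2).comp x
    (H.contMDiffAt_ψ hx.1)).continuousAt.continuousWithinAt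
  continuousOn_invFun y hy := ((H.contMDiffAt_χ (H.lt_norm_of_good (good_coord hy).1).2).comp y
    (contMDiffAt_coord hy)).continuousAt.continuousWithinAt

/-- **The gluing datum of `X = M ∪ Cap`.** [folklore] -/
def dX (H : EndHyp sf K R ψ χ R₁ J) : SmoothGlueData (𝓡 4) 𝓘(ℝ, E4) M (Cap R₁) E4 where
  glue := gX H
  contMDiffOn_glue x hx := ((contMDiffAt_ofCoord hx.2).comp x (H.contMDiffAt_ψ hx.1)).contMDiffWithinAt
  contMDiffOn_glue_symm y hy := ((H.contMDiffAt_χ (H.lt_norm_of_good (good_coord hy).1).2).comp y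
    (contMDiffAt_coord hy)).contMDiffWithinAt
  linA := ContinuousLinearEquiv.refl ℝ E4
  linB := ContinuousLinearEquiv.refl ℝ E4

variable (H : EndHyp sf K R ψ χ R₁ J)

/-- The glue of `dX`: source. [folklore] -/
theorem mem_dX_source {x : M} : x ∈ (dX H).glue.source ↔ x ∈ Kᶜ ∧ ψ x ∈ goodSet R₁ := Iff.rfl
/-- The glue of `dX`: target. [folklore] -/
theorem dX_target : (dX H).glue.target = capFin R₁ := rfl
/-- The glue of `dX`: the map. [folklore] -/
theorem dX_glue_apply (x : M) : (dX H).glue x = ofCoord (ψ x) := rfl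
/-- The glue of `dX`: the inverse map. [folklore] -/
theorem dX_glue_symm_apply (y : Cap R₁) : (dX H).glue.symm y = χ (coord y) := rfl

/-- **The graph of the gluing map `M ⇀ Cap` is closed** (Stub 1 ⇒ `‖ψ‖` locally bounded on `M`;
coordinates blow up at the wedge). [folklore] -/
theorem isClosed_graph_gX :
    IsClosed {p : M × Cap R₁ | p.1 ∈ (dX H).glue.source ∧ (dX H).glue p.1 = p.2} := by
  apply isClosed_graph_of_closure_subset_target
  rintro ⟨x, y⟩ hp
  rw [dX_target]
  by_contra hy
  obtain ⟨N, hN, R', hR'⟩ := H.exists_nhds_norm_ψ_lt x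
  obtain ⟨U, hU, hUB⟩ := exists_nhds_lt_norm_coord hy R'
  obtain ⟨⟨x', y'⟩, ⟨hxN, hyU⟩, hsrc, hgl⟩ := mem_closure_iff_nhds.1 hp _ (prod_mem_nhds hN hU)
  dsimp only at hxN hyU hsrc hgl
  have h1 : ‖ψ x'‖ < R' := hR' x' hxN hsrc.1
  have h2 : R' < ‖ψ x'‖ := hUB (ψ x') hsrc.2 (by rw [← dX_glue_apply H, hgl]; exact hyU)
  exact lt_irrefl _ (h1.trans h2)

/-- **`X = M ∪ Cap` is Hausdorff.** [folklore] -/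
theorem t2Space_X : T2Space (dX H).Glued := (dX H).t2Space_of_isClosed_graph (isClosed_graph_gX H)

end CapModel

/-- **Registered helper sub-goal `helper_capModelHausdorffModel`** (file `X2` of stub `stub_capModel`): under the
hypotheses of the stub, the glued model `X = M ∪ Cap` is a HAUSDORFF smooth `4`-manifold into which `M` embeds openly. [folklore] -/
theorem helper_capModelHausdorffModel :
    ∀ (M : Type) [TopologicalSpace M] [T2Space M] [SecondCountableTopology M]
      [ChartedSpace (EuclideanSpace ℝ (Fin 4)) M] [IsManifold (𝓡 4) ∞ M] [ConnectedSpace M]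
      (sf : Literature.Geometry.Kaehler.MForm (𝓡 4) M ℝ 2) (K : Set M) (R : ℝ)
      (ψ : M → EuclideanSpace ℝ (Fin 4)) (χ : EuclideanSpace ℝ (Fin 4) → M),
      Literature.Geometry.Kaehler.IsSmoothForm sf → Literature.Geometry.Kaehler.IsClosedForm sf →
      (∀ x (v : TangentSpace (𝓡 4) x), v ≠ 0 → ∃ w, sf x ![v, w] ≠ 0) →
      (∀ R', R ≤ R' → IsCompact (K ∪ {x | ‖ψ x‖ ≤ R'})) →
      ContMDiffOn (𝓡 4) 𝓘(ℝ, EuclideanSpace ℝ (Fin 4)) ∞ ψ Kᶜ →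
      ContMDiffOn 𝓘(ℝ, EuclideanSpace ℝ (Fin 4)) (𝓡 4) ∞ χ
        (Metric.closedBall (0 : EuclideanSpace ℝ (Fin 4)) R)ᶜ →
      Set.BijOn ψ Kᶜ (Metric.closedBall (0 : EuclideanSpace ℝ (Fin 4)) R)ᶜ →
      (∀ x, x ∈ Kᶜ → χ (ψ x) = x) →
      (∀ x, x ∈ Kᶜ → ∀ v w, sf x ![v, w] = Literature.Geometry.Symplectic.stdSymplecticForm
        (mfderiv (𝓡 4) 𝓘(ℝ, EuclideanSpace ℝ (Fin 4)) ψ x v)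
        (mfderiv (𝓡 4) 𝓘(ℝ, EuclideanSpace ℝ (Fin 4)) ψ x w)) →
      (∀ R', R < R' → IsOpen (K ∪ {x | x ∈ Kᶜ ∧ ‖ψ x‖ < R'})) →
      ∀ (R₁ : ℝ) (J : Literature.Geometry.Symplectic.AlmostComplexStructure (𝓡 4) ∞ M),
      R < R₁ → 0 < R₁ → J.IsTamedBy sf →
      (∀ x, x ∈ Kᶜ → R₁ < ‖ψ x‖ → ∀ (v : TangentSpace (𝓡 4) x) (a : EuclideanSpace ℝ (Fin 4)),
          a = mfderiv (𝓡 4) 𝓘(ℝ, EuclideanSpace ℝ (Fin 4)) ψ x v →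
          mfderiv (𝓡 4) 𝓘(ℝ, EuclideanSpace ℝ (Fin 4)) ψ x (J x v) =
            WithLp.toLp 2 ![-(a 1), a 0, -(a 3), a 2]) →
      ∃ (X : Type) (_ : TopologicalSpace X) (_ : T2Space X) (_ : ChartedSpace (EuclideanSpace ℝ (Fin 4)) X)
        (_ : IsManifold (𝓡 4) ∞ X) (ι : M → X), Function.Injective ι ∧ IsOpenMap ι := by
  intro M _ _ _ _ _ _ sf K R ψ χ h2 h3 h4 h5 h6 h7 h8 h9 h10 hopen R₁ J hR₁ hR₁pos hJt hJstd
  haveI : Fact (0 < R₁) := ⟨hR₁pos⟩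
  let H : CapModel.EndHyp sf K R ψ χ R₁ J :=
    { smooth := h2, closed := h3, nondeg := h4, ends := h5, smooth_ψ := h6, smooth_χ := h7, bij := h8,
      left_inv := h9, pullback_eq := h10, isOpen_trunc := hopen, lt_R₁ := hR₁, R₁_pos := hR₁pos,
      tame := hJt, Jstd := hJstd }
  exact ⟨(CapModel.dX H).Glued, inferInstance, CapModel.t2Space_X H, inferInstance, inferInstance,
    (CapModel.dX H).inl, (CapModel.dX H).inl_injective, (CapModel.dX H).isOpenMap_inl⟩

end Summit.SmoothPoincare4.SmoothPoincare4.Theorems.GromovRecognitionRelEnd.CrossCapLaurent
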